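import Literature.NumberTheory.EllipticCurves.ModularJacobianGammaOneCover
import Literature.NumberTheory.GaloisRepresentations.FrobeniusGeneration
import HarnessLib

/-!
# Buzzard 2000 Prop. 2.4 from the cover `J₀(N) → J₁(N)` on torsion (proofs only)

Sibling proof file of `ModularJacobianGammaOneCover.lean` (the hypothesis structure
`ModularJacobianGammaOneCover N ι M₁` — `ℚ`-structure of `J₀(N)` on `J0.tors N` with the
Eichler–Shimura relation, the Picard pull-back `π^*` to the `ℤ[T_p, ⟨d⟩]`-module `M₁ = J₁(N)(ℚ̄)_tors`,
Buzzard 2000 Lemma 2.3 on `ker π^*`, and Buzzard's appendix to Ribet–Stein Thm. 6.1 at weight `2` — and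
its existence fact `nonempty_modularJacobianGammaOneCover`). Theorems only (no definition, no new
fact; D-0026):

* `ModularJacobianGammaOneCover.not_isUnramifiedAt_or_frob_ne_scalar` — "`ρ(D_𝔓)` not within the
  scalars" implies "`ρ` ramified at `v`, or every arithmetic Frobenius above `v` is non-scalar"
  (`D_𝔓` is generated by inertia, a Frobenius and any open subgroup:
  `exists_eq_frobenius_pow_mul_of_mem_decompositionSubgroup`).
* `ModularJacobianGammaOneCover.exists_kernelDatum` — **the `J₁(N)` input of the printed proof of
  Prop. 2.4** (Buzzard 2000, p. 101, finite case: "set `Γ = Γ₁(M)` (by Lemma 2.3 it suffices to treat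
  this case) … Theorem 9.2 of [E1]"), in the exact binder shape of the residual hypothesis of
  `buzzard2000_multiplicityOne_gamma0_of_galoisData` / `…_of_eichlerShimura`
  (`ModularJacobianGaloisCharpolyRel.lean`, `ModularJacobianMultiplicityOneOfEichlerShimura.lean`): for
  the `𝕋/𝔪`-linear Galois representation `σ` on `J0 N[𝔪]` agreeing with the datum's `galAct`, the
  subspace `U = J0 N[𝔪] ∩ ker π^*` is `σ`-stable, carries a commuting action, and
  `dim (J0 N[𝔪] ⧸ U) ≤ 2` — because `π^*` embeds `J0 N[𝔪] ⧸ U` into `J₁(N)[𝔪₁]`,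
  `𝔪₁ = restrictHecke⁻¹(𝔪)`, which is `2`-dimensional over `ℤ[T_p,⟨d⟩]/𝔪₁ ≅ 𝕋/𝔪` by Thm. 6.1
  (dimension count on cardinalities).
* `buzzard2000_multiplicityOne_gamma0_of_gammaOneCover` — **the cited fact
  `buzzard2000_multiplicityOne_gamma0` from the one existence fact `nonempty_modularJacobianGammaOneCover`**,
  through the kernel reduction `buzzard2000_multiplicityOne_gamma0_of_galoisData` (Eichler–Shimura +
  Chebotarev + Boston–Lenstra–Ribet + Burnside + `J₀(N)[𝔪] ≠ 0`, all proved in the tree).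

HONESTY: a reduction of one cited input (Buzzard 2000 Prop. 2.4 at `Γ₀(N)`, whose printed proof its
author calls "a little optimistic", Ribet–Stein p. 81) to another (the `J₁(N)` statements with complete
printed proofs: appendix Thm. 6.1, Lemma 2.3, Eichler–Shimura); `nonempty_modularJacobianGammaOneCover`
is NOT proved; no summit statement (BirchSwinnertonDyer) is proved by this file.

## References
* [Buzzard2000LevelLoweringModTwo] K. Buzzard, Math. Res. Lett. 7 (2000), Lemma 2.3 and proof of
  Prop. 2.4 (p. 101).
* [RibetStein2008] K. Ribet, W. Stein, *Lectures on Serre's conjectures*, Appendix by K. Buzzard,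
  Thm. 6.1 (pp. 81–82).
* [NeukirchANT1999] J. Neukirch, *Algebraic Number Theory*, Ch. I §9 (decomposition and inertia groups).
-/

noncomputable section

open scoped MatrixGroups ModularForm NumberField

open CongruenceSubgroup Polynomial IsDedekindDomain

namespace Literature.NumberTheory.EllipticCurves.ModularForms

open GaloisRepresentations Rat.HeightOneSpectrum

section Glue

variable {N : ℕ} [NeZero N] {ι : AlgebraicClosure ℚ →+* ℂ}
  {M₁ : Type} [AddCommGroup M₁] [Module (heckeRing1 N 2) M₁]

namespace ModularJacobianGammaOneCover

/-- Non-scalar transfer: if some element of `D_𝔓` acts through a non-scalar matrix, then either `ρ`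
is ramified at `v` or every arithmetic Frobenius at every prime above `v` is non-scalar
(`D_𝔓` is generated by `I_𝔓`, a Frobenius and any open subgroup:
`exists_eq_frobenius_pow_mul_of_mem_decompositionSubgroup`; Neukirch, *Algebraic Number Theory*,
Ch. I §9, Prop. (9.4)–(9.5)). This is the step "`ρ(D_ℓ)` not contained within the scalars ⇒ the
conditions of the theorem" of Buzzard's Cor. 6.2 (Ribet–Stein p. 81), for the untwisted `ρ`.
[cite: NeukirchANT1999, Ch. I §9 Prop. (9.4)–(9.5)]
[cite: RibetStein2008, Appendix (K. Buzzard), Cor. 6.2 (p. 81)] -/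
theorem not_isUnramifiedAt_or_frob_ne_scalar {k : Type*} [Field k] [TopologicalSpace k]
    [DiscreteTopology k] (ρ : ModPGaloisRep ℚ k 2) (v : HeightOneSpectrum (𝓞 ℚ))
    (hns : ∀ 𝔓 ∈ v.primesAbove, ∃ s ∈ 𝔓.decompositionSubgroup (Field.absoluteGaloisGroup ℚ),
      ∀ c : k, ((ρ s : GL (Fin 2) k) : Matrix (Fin 2) (Fin 2) k) ≠ Matrix.scalar (Fin 2) c) :
    (¬ ρ.IsUnramifiedAt v) ∨
      ∀ 𝔓 ∈ v.primesAbove, ∀ φ : Field.absoluteGaloisGroup ℚ, IsArithFrobAt (𝓞 ℚ) φ 𝔓 →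
        ∀ c : k, ((ρ φ : GL (Fin 2) k) : Matrix (Fin 2) (Fin 2) k) ≠ Matrix.scalar (Fin 2) c := by
  by_cases hu : ρ.IsUnramifiedAt v
  · refine Or.inr fun 𝔓 h𝔓 φ hφ c hc => ?_
    obtain ⟨s, hs, hsn⟩ := hns 𝔓 h𝔓
    have hker : IsOpen ((ρ.toMonoidHom.ker : Subgroup (Field.absoluteGaloisGroup ℚ)) :
        Set (Field.absoluteGaloisGroup ℚ)) := by
      have e : ((ρ.toMonoidHom.ker : Subgroup (Field.absoluteGaloisGroup ℚ)) :
          Set (Field.absoluteGaloisGroup ℚ)) = ρ ⁻¹' {1} := by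
        ext g
        simp [MonoidHom.mem_ker]
      rw [e]
      exact (isOpen_discrete _).preimage (map_continuous ρ)
    obtain ⟨n, i, u, hi, hu', rfl⟩ :=
      exists_eq_frobenius_pow_mul_of_mem_decompositionSubgroup h𝔓 hφ hker hs
    apply hsn (c ^ n)
    have hi' : ρ i = 1 := hu 𝔓 h𝔓 i hi
    have hu'' : ρ u = 1 := by simpa [MonoidHom.mem_ker] using hu'
    have h1 : ρ (φ ^ n * i * u) = ρ φ ^ n := by
      rw [map_mul, map_mul, hi', hu'', mul_one, mul_one, map_pow]
    rw [h1, Units.val_pow_eq_pow_val, hc, ← map_pow]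
  · exact Or.inl hu

variable (Cv : ModularJacobianGammaOneCover N ι M₁)

set_option maxHeartbeats 400000 in
set_option synthInstance.maxHeartbeats 80000 in
/-- **The `J₁(N)` input of Buzzard's proof of Prop. 2.4 from the cover datum** (Buzzard 2000,
p. 101: "Choose any `M` odd, set `Γ = Γ₁(M)` (by Lemma 2.3 it suffices to treat this case) …";
here in the exact binder shape of the hypothesis `hJ₁`/`hD` of
`buzzard2000_multiplicityOne_gamma0_of_eichlerShimura` / `…_of_galoisData`). For `N` odd, a maximal
`𝔪 ∋ 2` of `𝕋_ℤ(Γ₀(N))`, `k ⊇ 𝕋/𝔪` algebraically closed, `ρ : Γ_ℚ → GL₂(k)` with the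
Eichler–Shimura Frobenius polynomials away from `2N`, irreducible and non-scalar on `D₂`, and the
`𝕋/𝔪`-linear representation `σ` on `J0 N[𝔪]` agreeing with the datum's `galAct`: the subspace
`U = J0 N[𝔪] ∩ ker π^*` is `σ`-stable (π^* is `Γ_ℚ`-equivariant), carries a commuting action
(Lemma 2.3), and `dim_{𝕋/𝔪} (J0 N[𝔪] ⧸ U) ≤ 2`: `π^*` embeds `J0 N[𝔪] ⧸ U` into `J₁(N)[𝔪₁]`,
`𝔪₁ = restrictHecke⁻¹(𝔪)` (a maximal ideal of `ℤ[T_p, ⟨d⟩]` with the same residue field, containing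
`2`), which is `2`-dimensional by the appendix Thm. 6.1 applied to `ρ` (its hypotheses: the same
Frobenius polynomials since `⟨p⟩ ↦ 1`; "ramified or Frobenius non-scalar" from "non-scalar on `D₂`"
by `not_isUnramifiedAt_or_frob_ne_scalar`); the dimension count is done on cardinalities
(`|𝕋/𝔪|^d ≤ |J₁(N)[𝔪₁]| = |𝕋/𝔪|²`). [cite: Buzzard2000LevelLoweringModTwo, Lemma 2.3 and proof of Prop. 2.4 (p. 101)]
[cite: RibetStein2008, Appendix (K. Buzzard), Thm. 6.1 (pp. 81–82)] -/
theorem exists_kernelDatum (hN : Odd N) (𝔪 : Ideal (HeckeRing0 N 2)) (h𝔪 : 𝔪.IsMaximal)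
    (h2 : (2 : HeckeRing0 N 2) ∈ 𝔪)
    (k : Type) [Field k] [IsAlgClosed k] [TopologicalSpace k] [DiscreteTopology k]
    (ι' : HeckeRing0 N 2 ⧸ 𝔪 →+* k) (ρ : ModPGaloisRep ℚ k 2)
    (hρ : ∀ v : HeightOneSpectrum (𝓞 ℚ), ¬ ((primesEquiv v : Nat.Primes) : ℕ) ∣ 2 * N →
      ρ.IsUnramifiedAt v ∧
        ρ.HasFrobCharpolyAt v
          (X ^ 2
            - C (ι' (Ideal.Quotient.mk 𝔪 (HeckeRing0.T N 2
                ((primesEquiv v : Nat.Primes) : ℕ) (primesEquiv v : Nat.Primes).2))) * X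
            + C (((primesEquiv v : Nat.Primes) : ℕ) : k)))
    (hirr : FramedRep.IsIrreducible ρ)
    (hns : ∀ v : HeightOneSpectrum (𝓞 ℚ), ((primesEquiv v : Nat.Primes) : ℕ) = 2 →
      ∀ 𝔓 ∈ v.primesAbove, ∃ s ∈ 𝔓.decompositionSubgroup (Field.absoluteGaloisGroup ℚ),
        ∀ c : k, ((ρ s : GL (Fin 2) k) : Matrix (Fin 2) (Fin 2) k) ≠ Matrix.scalar (Fin 2) c)
    (σ : Representation (HeckeRing0 N 2 ⧸ 𝔪) (Field.absoluteGaloisGroup ℚ)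
      (Submodule.torsionBySet (HeckeRing0 N 2) (J0 N) 𝔪))
    (hσ : ∀ (g : Field.absoluteGaloisGroup ℚ)
      (x : Submodule.torsionBySet (HeckeRing0 N 2) (J0 N) 𝔪) (x' : J0.tors N), (x' : J0 N) = x →
      ((σ g x : Submodule.torsionBySet (HeckeRing0 N 2) (J0 N) 𝔪) : J0 N)
        = ((Cv.galAct g x' : J0.tors N) : J0 N)) :
    ∃ U : Submodule (HeckeRing0 N 2 ⧸ 𝔪) (Submodule.torsionBySet (HeckeRing0 N 2) (J0 N) 𝔪),
      (∀ (g : Field.absoluteGaloisGroup ℚ), ∀ x ∈ U, σ g x ∈ U) ∧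
      (∀ (g h : Field.absoluteGaloisGroup ℚ), ∀ x ∈ U, σ g (σ h x) = σ h (σ g x)) ∧
      Module.finrank (HeckeRing0 N 2 ⧸ 𝔪)
        (Submodule.torsionBySet (HeckeRing0 N 2) (J0 N) 𝔪 ⧸ U) ≤ 2 := by
  classical
  haveI := h𝔪
  -- notation
  set T := HeckeRing0 N 2 with hT
  letI : Field (T ⧸ 𝔪) := Ideal.Quotient.field 𝔪
  set V := Submodule.torsionBySet (HeckeRing0 N 2) (J0 N) 𝔪 with hV
  -- `V ⊆ J0.tors N`
  have hVt : ∀ x : V, (x : J0 N) ∈ J0.tors N := fun x =>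
    J0.torsionBy_le_tors N two_ne_zero (J0.torsionBySet_le_torsionBy N h2 x.2)
  let lift : V → J0.tors N := fun x => ⟨x, hVt x⟩
  have hlift_add : ∀ x y : V, lift (x + y) = lift x + lift y := fun x y => Subtype.ext rfl
  have hlift_σ : ∀ (g : Field.absoluteGaloisGroup ℚ) (x : V), lift (σ g x) = Cv.galAct g (lift x) :=
    fun g x => Subtype.ext (hσ g x (lift x) rfl)
  -- `π = π^* ∘ lift : V →+ M₁`
  let π : V →+ M₁ :=
    { toFun := fun x => Cv.pullback (lift x)
      map_zero' := by
        have : lift 0 = 0 := Subtype.ext rfl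
        rw [this, map_zero]
      map_add' := fun x y => by rw [hlift_add, map_add] }
  have hπ : ∀ x : V, π x = Cv.pullback (lift x) := fun _ => rfl
  -- Hecke compatibility: `π (t • x) = h • π x` for `restrictHecke h = t`
  have hθ := restrictHecke_surjective N 2
  have hπ_smul : ∀ (t : T) (x : V), ∃ h : heckeRing1 N 2, π (t • x) = h • π x := by
    intro t x
    obtain ⟨h, rfl⟩ := hθ t
    refine ⟨h, ?_⟩
    have : lift (restrictHecke N 2 h • x) = restrictHecke N 2 h • lift x := Subtype.ext rfl
    rw [hπ, hπ, this, Cv.pullback_smul]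
  -- the subspace `U = V ∩ ker π^*`
  let U : Submodule (T ⧸ 𝔪) V :=
    { carrier := {x | π x = 0}
      zero_mem' := map_zero π
      add_mem' := fun {x y} hx hy => by
        simp only [Set.mem_setOf_eq] at hx hy ⊢
        rw [map_add, hx, hy, add_zero]
      smul_mem' := fun c x hx => by
        simp only [Set.mem_setOf_eq] at hx ⊢
        obtain ⟨t, rfl⟩ := Ideal.Quotient.mk_surjective c
        rw [Submodule.torsionBySet.mk_smul]
        obtain ⟨h, hh⟩ := hπ_smul t x
        rw [hh, hx, smul_zero] }
  have hU : ∀ x : V, x ∈ U ↔ π x = 0 := fun x => Iff.rfl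
  refine ⟨U, ?_, ?_, ?_⟩
  · -- `σ`-stable: `π^*` is `Γ_ℚ`-equivariant
    intro g x hx
    rw [hU] at hx ⊢
    rw [hπ, hlift_σ, Cv.pullback_galAct, ← hπ, hx, map_zero]
  · -- commuting action on `U`: Buzzard's Lemma 2.3
    intro g h x hx
    rw [hU] at hx
    apply Subtype.ext
    rw [hσ g (σ h x) (lift (σ h x)) rfl, hσ h (σ g x) (lift (σ g x)) rfl, hlift_σ, hlift_σ]
    exact congrArg Subtype.val (Cv.galAct_comm_of_pullback_eq_zero g h (lift x) hx)
  · -- dimension: `V ⧸ U ↪ J₁(N)[𝔪₁]`, `𝔪₁ = restrictHecke⁻¹ 𝔪`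
    -- the maximal ideal `𝔪₁` of `H = ℤ[T_p, ⟨d⟩]` and the residue field isomorphism
    set θ' : heckeRing1 N 2 →+* T ⧸ 𝔪 := (Ideal.Quotient.mk 𝔪).comp (restrictHecke N 2) with hθ'
    have hθ's : Function.Surjective θ' := Ideal.Quotient.mk_surjective.comp hθ
    set 𝔪₁ : Ideal (heckeRing1 N 2) := RingHom.ker θ' with h𝔪₁
    haveI h𝔪₁max : 𝔪₁.IsMaximal := RingHom.ker_isMaximal_of_surjective θ' hθ's
    have hmem₁ : ∀ h : heckeRing1 N 2, h ∈ 𝔪₁ ↔ restrictHecke N 2 h ∈ 𝔪 := fun h => by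
      rw [h𝔪₁, RingHom.mem_ker, hθ', RingHom.comp_apply, Ideal.Quotient.eq_zero_iff_mem]
    have h2₁ : ((2 : ℕ) : heckeRing1 N 2) ∈ 𝔪₁ := by
      rw [hmem₁, map_natCast]
      exact_mod_cast h2
    obtain ⟨e, he⟩ : ∃ e : heckeRing1 N 2 ⧸ 𝔪₁ ≃+* T ⧸ 𝔪, ∀ h : heckeRing1 N 2,
        e (Ideal.Quotient.mk 𝔪₁ h) = Ideal.Quotient.mk 𝔪 (restrictHecke N 2 h) :=
      ⟨RingHom.quotientKerEquivOfSurjective hθ's, fun h =>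
        RingHom.quotientKerEquivOfSurjective_apply_mk hθ's h⟩
    obtain ⟨ι'', hι''⟩ : ∃ ι'' : heckeRing1 N 2 ⧸ 𝔪₁ →+* k, ∀ h : heckeRing1 N 2,
        ι'' (Ideal.Quotient.mk 𝔪₁ h) = ι' (Ideal.Quotient.mk 𝔪 (restrictHecke N 2 h)) :=
      ⟨ι'.comp e.toRingHom, fun h => by rw [RingHom.comp_apply, RingEquiv.toRingHom_eq_coe,
        RingEquiv.coe_toRingHom, he]⟩
    -- Thm. 6.1 on `J₁(N)[𝔪₁]`
    have hN2 : ¬ 2 ∣ N := fun h => (Nat.not_even_iff_odd.mpr hN) (even_iff_two_dvd.mpr h)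
    have hdim₁ : Module.finrank (heckeRing1 N 2 ⧸ 𝔪₁)
        (Submodule.torsionBySet (heckeRing1 N 2) M₁ 𝔪₁) = 2 := by
      refine Cv.finrank_torsionBySet_eq_two₁ 2 Nat.prime_two hN2 𝔪₁ h𝔪₁max h2₁ k ι'' ρ ?_ hirr ?_
      · intro v hv
        have hv' : ¬ ((primesEquiv v : Nat.Primes) : ℕ) ∣ 2 * N := by rwa [mul_comm] at hv
        refine ⟨(hρ v hv').1, ?_⟩
        have hP := (hρ v hv').2
        have e1 : ι'' (Ideal.Quotient.mk 𝔪₁ (heckeRing1.T N 2 (primesEquiv v))) =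
            ι' (Ideal.Quotient.mk 𝔪 (HeckeRing0.T N 2 ((primesEquiv v : Nat.Primes) : ℕ)
              (primesEquiv v : Nat.Primes).2)) := by
          rw [hι'', restrictHecke_T]
        have e2 : ι'' (Ideal.Quotient.mk 𝔪₁
            (heckeRing1.diamond N 2 ((((primesEquiv v : Nat.Primes) : ℕ) : ZMod N)))) = 1 := by
          rw [hι'', restrictHecke_diamond, map_one, map_one]
        rw [e1, e2, mul_one]
        exact hP
      · intro v hv
        exact not_isUnramifiedAt_or_frob_ne_scalar ρ v (hns v hv)
    -- finiteness and cardinalities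
    haveI hVfin : Finite V := J0.finite_torsionBySet N two_ne_zero h2
    haveI : Module.Finite (T ⧸ 𝔪) V := Module.Finite.of_finite
    haveI : Module.Finite (T ⧸ 𝔪) (V ⧸ U) := inferInstance
    haveI hFfin : Finite (T ⧸ 𝔪) := HeckeRing0.finite_quotient_of_natCast_mem N two_ne_zero
      (by exact_mod_cast h2)
    haveI : Finite (heckeRing1 N 2 ⧸ 𝔪₁) := Finite.of_equiv _ e.toEquiv.symm
    set V₁ := Submodule.torsionBySet (heckeRing1 N 2) M₁ 𝔪₁ with hV₁
    letI : Field (heckeRing1 N 2 ⧸ 𝔪₁) := Ideal.Quotient.field 𝔪₁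
    haveI : Module.Free (heckeRing1 N 2 ⧸ 𝔪₁) V₁ := Module.Free.of_divisionRing _ _
    haveI : Module.Finite (heckeRing1 N 2 ⧸ 𝔪₁) V₁ :=
      Module.finite_of_finrank_pos (by rw [hdim₁]; exact two_pos)
    haveI : Finite V₁ := Module.finite_of_finite (heckeRing1 N 2 ⧸ 𝔪₁)
    -- `π` lands in `V₁`
    have hπV₁ : ∀ x : V, π x ∈ V₁ := by
      intro x
      rw [hV₁, Submodule.mem_torsionBySet_iff]
      rintro ⟨h, hh⟩
      have hh' : restrictHecke N 2 h ∈ 𝔪 := (hmem₁ h).mp hh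
      have : lift (restrictHecke N 2 h • x) = restrictHecke N 2 h • lift x := Subtype.ext rfl
      show h • Cv.pullback (lift x) = 0
      rw [← Cv.pullback_smul, ← this]
      have hx0 : restrictHecke N 2 h • x = 0 := by
        apply Subtype.ext
        exact (Submodule.mem_torsionBySet_iff _ _).mp x.2 ⟨_, hh'⟩
      rw [hx0]
      have : lift 0 = 0 := Subtype.ext rfl
      rw [this, map_zero]
    -- cardinality count: `|V| = |U| · |V ⧸ U|` and `|V| = |ker π| · |range π| ≤ |U| · |V₁|`
    have hcardV : Nat.card V = Nat.card U * Nat.card (V ⧸ U) :=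
      Submodule.card_eq_card_quotient_mul_card U
    have hker : Nat.card π.ker = Nat.card U := by
      refine Nat.card_congr (Equiv.subtypeEquivRight fun x => ?_)
      rw [AddMonoidHom.mem_ker]
      exact (hU x).symm
    have hrange : Nat.card π.range ≤ Nat.card V₁ := by
      refine Nat.card_le_card_of_injective (fun y => (⟨y.1, ?_⟩ : V₁)) ?_
      · obtain ⟨x, hx⟩ := y.2
        rw [← hx]
        exact hπV₁ x
      · intro y y' hyy'
        simp only [Subtype.mk.injEq] at hyy'
        exact Subtype.ext hyy'
    have hcardV' : Nat.card V = Nat.card (V ⧸ π.ker) * Nat.card π.ker :=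
      AddSubgroup.card_eq_card_quotient_mul_card_addSubgroup π.ker
    have hquot : Nat.card (V ⧸ π.ker) = Nat.card π.range :=
      Nat.card_congr (QuotientAddGroup.quotientKerEquivRange π).toEquiv
    have hUpos : 0 < Nat.card U := Nat.card_pos
    have hle : Nat.card (V ⧸ U) ≤ Nat.card V₁ := by
      have h1 : Nat.card U * Nat.card (V ⧸ U) ≤ Nat.card U * Nat.card V₁ := by
        rw [← hcardV, hcardV', hquot, hker, mul_comm]
        exact Nat.mul_le_mul_left _ hrange
      exact Nat.le_of_mul_le_mul_left h1 hUpos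
    -- `|V ⧸ U| = |𝕋/𝔪|^d`, `|V₁| = |H/𝔪₁|^2 = |𝕋/𝔪|^2`
    rw [Module.natCard_eq_pow_finrank (K := T ⧸ 𝔪) (V := V ⧸ U),
      Module.natCard_eq_pow_finrank (K := heckeRing1 N 2 ⧸ 𝔪₁) (V := V₁), hdim₁,
      Nat.card_congr e.toEquiv] at hle
    have h1lt : 1 < Nat.card (T ⧸ 𝔪) := Finite.one_lt_card
    exact (Nat.pow_le_pow_iff_right h1lt).mp hle

end ModularJacobianGammaOneCover

/-- **Buzzard 2000 Prop. 2.4 (`buzzard2000_multiplicityOne_gamma0`) from the one existence fact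
`nonempty_modularJacobianGammaOneCover`** (the `ℚ`-structure of `J₀(N) → J₁(N)` on torsion with
Eichler–Shimura, Buzzard's Lemma 2.3 and the appendix Thm. 6.1): the printed proof of Prop. 2.4
(finite case, p. 101) assembled — Galois datum with Eichler–Shimura (field `galAct_eichlerShimura`)
and the `J₁(N)` input (`ModularJacobianGammaOneCover.exists_kernelDatum`) fed into the kernel
reduction `buzzard2000_multiplicityOne_gamma0_of_galoisData` (Chebotarev, Boston–Lenstra–Ribet,
Burnside, `J₀(N)[𝔪] ≠ 0`), at the embedding `IsAlgClosed.lift : ℚ̄ → ℂ`. A reduction of one cited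
fact to another (more standard, complete in print); nothing here proves the input or any summit
statement. [cite: Buzzard2000LevelLoweringModTwo, proof of Prop. 2.4 (p. 101)]
[cite: RibetStein2008, Appendix (K. Buzzard), Thm. 6.1 (pp. 81–82)] -/
theorem buzzard2000_multiplicityOne_gamma0_of_gammaOneCover
    (h : nonempty_modularJacobianGammaOneCover) : buzzard2000_multiplicityOne_gamma0 := by
  refine buzzard2000_multiplicityOne_gamma0_of_galoisData
    fun N _ hN 𝔪 h𝔪 h2 k _ _ _ _ ι' ρ hρ hirr hns => ?_
  haveI : Algebra.IsAlgebraic ℚ (AlgebraicClosure ℚ) := AlgebraicClosure.isAlgebraic ℚ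
  let ιℂ : AlgebraicClosure ℚ →+* ℂ :=
    (IsAlgClosed.lift (R := ℚ) (S := AlgebraicClosure ℚ) (M := ℂ)).toRingHom
  obtain ⟨M₁, _, _, ⟨Cv⟩⟩ := h N ιℂ
  refine ⟨ιℂ, Cv.toModularJacobianGaloisData, ?_,
    fun σ hσ => Cv.exists_kernelDatum hN 𝔪 h𝔪 h2 k ι' ρ hρ hirr hns σ hσ⟩
  intro v hv 𝔓 h𝔓 φ hφ x hx
  have hvN : ¬ ((primesEquiv v : Nat.Primes) : ℕ) ∣ N := fun h' => hv (dvd_mul_of_dvd_right h' 2)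
  have hv2 : ¬ ((primesEquiv v : Nat.Primes) : ℕ) ∣ 2 := fun h' => hv (dvd_mul_of_dvd_left h' N)
  exact Cv.galAct_eichlerShimura v hvN 𝔓 h𝔓 φ hφ 2 hv2 x (by exact_mod_cast hx)

end Glue

end Literature.NumberTheory.EllipticCurves.ModularForms

end
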